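import Mathlib
import Literature.MathematicalPhysics.QuantumFieldTheory.Balaban1983to89.B5Value126

/-!
# B5 pp. 21–22 (Sect. C): the infimum in (1.24) «is acquired at the function λ₀» — minimality of
# `λ₀` over `{λ : Q′_kλ = 0}` and the exponent split behind (1.24), for the TYPED operators

Source: T. Bałaban, *Propagators and renormalization transformations for lattice gauge
theories. I*, Commun. Math. Phys. 95 (1984) 17–40 (`Balaban1984PropagatorsI`, "B5"), renders
`b2b-balaban-ref1/pages/1984-cmp95-propagators-rt-I/…-p005-x2.png` (journal p. 21) and
`…-p006-x2.png` (journal p. 22), both read as images this session.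

## What the paper prints (verbatim)

p. 21: «Now we will calculate the integral inside the above expression:
∫dλδ(Q′_kλ)exp(−(1/2α)⟨∂*A^λ, ∂*A^λ⟩) = ∫dλδ(Q′_kλ)exp(−(1/2α)‖∂*∂λ‖²)
  · exp(−(1/α) inf_{λ:Q′_kλ=0} ½‖∂*A − ∂*∂λ‖²), (1.24)
and the infimum can be calculated using Lagrange multipliers. Introducing»
p. 22: «g(λ, ω) = ½‖∂*A − Δλ‖² + ⟨ω, Q′_kλ⟩, we have the equations
δg(λ, ω)/δλ = Δ²λ − Δ∂*A + Q′*_kω = 0, δg(λ, ω)/δω = Q′_kλ = 0. (1.25)»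
p. 22: «… so ω = (Q′_kΔ⁻²Q′*_k)⁻¹Q′_kΔ⁻¹∂*A and the infimum in (1.24) is acquired at the function
λ₀ = Δ⁻¹∂*A − Δ⁻²Q′*_k(Q′_kΔ⁻²Q′*_k)⁻¹Q′_kΔ⁻¹∂*A.»

## What is typed and certified here (kernel-checked, zero sorry)

With the typed operators (`Q′_k = QsOp n M`, `Δ = ∂*∂ = LapS (fine n M) c`, `c ≠ 0`, `∂*A` = any
`b ⊥ 1`, `λ₀ = B5Value126.lambda0`, `ω₀ = B5Value126.omega0`, norms `‖v‖² = star v ⬝ᵥ v`):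
* `LapS_residual` — `Δ(∂*A − Δλ₀) = Q′*_kω₀` ((1.25)₁ rearranged);
* `cross_zero`, `cross_zero'` — `⟨Δμ, ∂*A − Δλ₀⟩ = 0 = ⟨∂*A − Δλ₀, Δμ⟩` whenever `Q′_kμ = 0`
  (the Lagrange-multiplier orthogonality: `⟨Δμ, ∂*A − Δλ₀⟩ = ⟨Q′_kμ, ω₀⟩ = 0`);
* `norm_split` — `‖∂*A − Δ(λ₀ + μ)‖² = ‖∂*A − Δλ₀‖² + ‖Δμ‖²` for `Q′_kμ = 0`: this is the
  exponent identity which, after the translation `λ → λ₀ + λ` (admissible: `Q′_kλ₀ = 0`,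
  `B5Value126.QsOp_lambda0`), splits the integrand of (1.24) into `exp(−(1/2α)‖Δλ‖²)` times the
  constant `exp(−(1/α)·½‖∂*A − Δλ₀‖²)`;
* `lambda0_min` — `‖∂*A − Δλ₀‖² ≤ ‖∂*A − Δλ‖²` for every `λ` with `Q′_kλ = 0` (in `ℂ` with the
  star order), and `infimum_124` — «the infimum in (1.24) is acquired at the function λ₀»:
  `½‖∂*A − Δλ₀‖²` is the LEAST element of `{½‖∂*A − Δλ‖² : Q′_kλ = 0}` (`IsLeast`).

## What is NOT certified here

The Gaussian integral (1.24) itself and (1.27)/(1.28) (no integration is typed; only the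
exponent algebra and the minimisation); fields complex, `η^d`-weights dropped (common factor).
-/

open scoped BigOperators Matrix ComplexConjugate ComplexOrder
open Finset Complex Matrix

namespace Literature.MathematicalPhysics.QuantumFieldTheory.Balaban1983to89.B5Infimum124

open Literature.MathematicalPhysics.QuantumFieldTheory.Balaban1983to89.B5Prop11Plancherel
open Literature.MathematicalPhysics.QuantumFieldTheory.Balaban1983to89.B5Action121
open Literature.MathematicalPhysics.QuantumFieldTheory.Balaban1983to89.B5Block118
open Literature.MathematicalPhysics.QuantumFieldTheory.Balaban1983to89.B5LaplaceSpectral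
open Literature.MathematicalPhysics.QuantumFieldTheory.Balaban1983to89.B5LaplaceInverse
open Literature.MathematicalPhysics.QuantumFieldTheory.Balaban1983to89.B5Substitution125
open Literature.MathematicalPhysics.QuantumFieldTheory.Balaban1983to89.B5Value126

noncomputable section

variable {d : ℕ} (n : ℕ) [NeZero n] (M : Fin d → ℕ) [hM : ∀ μ, NeZero (M μ)] (c : ℂ)

omit hM in
/-- `⟨x, A*y⟩ = ⟨Ax, y⟩` (adjoint in the `star · ⬝ᵥ ·` pairing). [folklore] -/
theorem adj_dot {m k : Type*} [Fintype m] [Fintype k] (A : Matrix k m ℂ) (x : m → ℂ) (y : k → ℂ) :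
    star x ⬝ᵥ (Aᴴ *ᵥ y) = star (A *ᵥ x) ⬝ᵥ y := by
  rw [Matrix.dotProduct_mulVec, ← Matrix.star_mulVec]

/-- `Δ(∂*A − Δλ₀) = Q′*_kω₀` for `∂*A = b ⊥ 1`, `c ≠ 0` ((1.25)₁ at `(λ₀, ω₀)`, rearranged).
[cite: Balaban1984PropagatorsI, (1.25) p.22] -/
theorem LapS_residual (hc : c ≠ 0) (b : Tor (fine n M) → ℂ) (hb : ∑ x, b x = 0) :
    LapS (fine n M) c *ᵥ (b - LapS (fine n M) c *ᵥ lambda0 n M c b)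
      = (QsOp n M)ᴴ *ᵥ omega0 n M c b := by
  have h := eq125_lambda0 n M c hc b hb
  rw [Matrix.mulVec_sub]
  linear_combination -h

/-- Lagrange orthogonality: `⟨Δμ, ∂*A − Δλ₀⟩ = ⟨Q′_kμ, ω₀⟩ = 0` for `Q′_kμ = 0`
(`∂*A = b ⊥ 1`, `c ≠ 0`). [folklore] -/
theorem cross_zero (hc : c ≠ 0) (b : Tor (fine n M) → ℂ) (hb : ∑ x, b x = 0)
    (μ : Tor (fine n M) → ℂ) (hμ : QsOp n M *ᵥ μ = 0) :
    star (LapS (fine n M) c *ᵥ μ) ⬝ᵥ (b - LapS (fine n M) c *ᵥ lambda0 n M c b) = 0 := by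
  rw [← adj_dot, (LapS_isHermitian (fine n M) c).eq, LapS_residual n M c hc b hb, adj_dot, hμ,
    star_zero, zero_dotProduct]

/-- the conjugate cross term: `⟨∂*A − Δλ₀, Δμ⟩ = 0` for `Q′_kμ = 0`. [folklore] -/
theorem cross_zero' (hc : c ≠ 0) (b : Tor (fine n M) → ℂ) (hb : ∑ x, b x = 0)
    (μ : Tor (fine n M) → ℂ) (hμ : QsOp n M *ᵥ μ = 0) :
    star (b - LapS (fine n M) c *ᵥ lambda0 n M c b) ⬝ᵥ (LapS (fine n M) c *ᵥ μ) = 0 := by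
  rw [star_dotProduct, cross_zero n M c hc b hb μ hμ, star_zero]

/-- The exponent split behind (1.24): `‖∂*A − Δ(λ₀ + μ)‖² = ‖∂*A − Δλ₀‖² + ‖Δμ‖²` for
`Q′_kμ = 0` (`∂*A = b ⊥ 1`, `c ≠ 0`); (1.24) follows by the translation `λ → λ₀ + λ`, admissible
since `Q′_kλ₀ = 0`. [cite: Balaban1984PropagatorsI, (1.24) p.21] -/
theorem norm_split (hc : c ≠ 0) (b : Tor (fine n M) → ℂ) (hb : ∑ x, b x = 0)
    (μ : Tor (fine n M) → ℂ) (hμ : QsOp n M *ᵥ μ = 0) :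
    star (b - LapS (fine n M) c *ᵥ (lambda0 n M c b + μ))
        ⬝ᵥ (b - LapS (fine n M) c *ᵥ (lambda0 n M c b + μ))
      = star (b - LapS (fine n M) c *ᵥ lambda0 n M c b)
          ⬝ᵥ (b - LapS (fine n M) c *ᵥ lambda0 n M c b)
        + star (LapS (fine n M) c *ᵥ μ) ⬝ᵥ (LapS (fine n M) c *ᵥ μ) := by
  have h1 := cross_zero n M c hc b hb μ hμ
  have h2 := cross_zero' n M c hc b hb μ hμ
  have hr : b - LapS (fine n M) c *ᵥ (lambda0 n M c b + μ)
      = (b - LapS (fine n M) c *ᵥ lambda0 n M c b) - LapS (fine n M) c *ᵥ μ := by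
    rw [Matrix.mulVec_add]; abel
  have key : ∀ r v : Tor (fine n M) → ℂ, star v ⬝ᵥ r = 0 → star r ⬝ᵥ v = 0 →
      star (r - v) ⬝ᵥ (r - v) = star r ⬝ᵥ r + star v ⬝ᵥ v := by
    intro r v e1 e2
    rw [star_sub, sub_dotProduct, dotProduct_sub, dotProduct_sub, e1, e2]
    ring
  rw [hr]
  exact key _ _ h1 h2

/-- Minimality of `λ₀` over the constraint set of (1.24): `‖∂*A − Δλ₀‖² ≤ ‖∂*A − Δλ‖²` for every
`λ` with `Q′_kλ = 0` (`∂*A = b ⊥ 1`, `c ≠ 0`; star order on `ℂ`).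
[cite: Balaban1984PropagatorsI, Sect. C p.22] -/
theorem lambda0_min (hc : c ≠ 0) (b : Tor (fine n M) → ℂ) (hb : ∑ x, b x = 0)
    (lam : Tor (fine n M) → ℂ) (hlam : QsOp n M *ᵥ lam = 0) :
    star (b - LapS (fine n M) c *ᵥ lambda0 n M c b) ⬝ᵥ (b - LapS (fine n M) c *ᵥ lambda0 n M c b)
      ≤ star (b - LapS (fine n M) c *ᵥ lam) ⬝ᵥ (b - LapS (fine n M) c *ᵥ lam) := by
  have hμ : QsOp n M *ᵥ (lam - lambda0 n M c b) = 0 := by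
    rw [Matrix.mulVec_sub, hlam, QsOp_lambda0 n M c hc b, sub_zero]
  have h := norm_split n M c hc b hb (lam - lambda0 n M c b) hμ
  have hl : lambda0 n M c b + (lam - lambda0 n M c b) = lam := by abel
  rw [hl] at h
  rw [h]
  exact le_add_of_nonneg_right (dotProduct_star_self_nonneg _)

/-- «… and the infimum in (1.24) is acquired at the function λ₀ = Δ⁻¹∂*A − Δ⁻²Q′*_k(Q′_kΔ⁻²Q′*_k)⁻¹
Q′_kΔ⁻¹∂*A»: `½‖∂*A − Δλ₀‖²` is the least element of `{½‖∂*A − Δλ‖² : Q′_kλ = 0}` — attained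
(`Q′_kλ₀ = 0`) and minimal (`∂*A = b ⊥ 1`, `c ≠ 0`; star order on `ℂ`).
[cite: Balaban1984PropagatorsI, (1.24) p.21 and Sect. C p.22] -/
theorem infimum_124 (hc : c ≠ 0) (b : Tor (fine n M) → ℂ) (hb : ∑ x, b x = 0) :
    IsLeast ((fun lam : Tor (fine n M) → ℂ =>
        (1 / 2 : ℂ) * (star (b - LapS (fine n M) c *ᵥ lam) ⬝ᵥ (b - LapS (fine n M) c *ᵥ lam)))
        '' {lam | QsOp n M *ᵥ lam = 0})
      ((1 / 2 : ℂ) * (star (b - LapS (fine n M) c *ᵥ lambda0 n M c b)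
        ⬝ᵥ (b - LapS (fine n M) c *ᵥ lambda0 n M c b))) := by
  refine ⟨⟨lambda0 n M c b, QsOp_lambda0 n M c hc b, rfl⟩, ?_⟩
  rintro _ ⟨lam, hlam, rfl⟩
  -- `0 ≤ ½` in the star order of `ℂ` (cf. `Literature.MathematicalPhysics.QuantumLattice.GinibreXY.
  -- one_half_nonneg`, not imported here to keep the B5 chain free of cross-topic imports)
  have h2 : (0 : ℂ) ≤ 1 / 2 := by
    rw [show (1 / 2 : ℂ) = ((1 / 2 : ℝ) : ℂ) by push_cast; ring]
    exact Complex.zero_le_real.mpr (by norm_num)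
  exact mul_le_mul_of_nonneg_left (lambda0_min n M c hc b hb lam hlam) h2

/-- The value of the infimum, combined with (1.26): the least element equals `½⟨∂*A, PcT ∂*A⟩`
(`∂*A = b ⊥ 1`, `c ≠ 0`). [cite: Balaban1984PropagatorsI, (1.26) p.22] -/
theorem infimum_124_value (hc : c ≠ 0) (b : Tor (fine n M) → ℂ) (hb : ∑ x, b x = 0) :
    IsLeast ((fun lam : Tor (fine n M) → ℂ =>
        (1 / 2 : ℂ) * (star (b - LapS (fine n M) c *ᵥ lam) ⬝ᵥ (b - LapS (fine n M) c *ᵥ lam)))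
        '' {lam | QsOp n M *ᵥ lam = 0})
      ((1 / 2 : ℂ) * (star b ⬝ᵥ (PcT n M c *ᵥ b))) := by
  rw [← value_126b n M c hc b, ← value_126a n M c hc b hb]
  exact infimum_124 n M c hc b hb

end

end Literature.MathematicalPhysics.QuantumFieldTheory.Balaban1983to89.B5Infimum124
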